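import Mathlib.Data.Finsupp.Weight
import Mathlib.Algebra.BigOperators.Group.Finset.Basic
import Mathlib.Data.Fin.Basic
import HarnessLib

/-!
# Purely inseparable four-folds — L-LIGHT KILL, part F5a: three small tools (pigeonhole on a bounded colour, uniqueness of a characterised
# minimum, four distinct letters exhaust `Fin 4`) (cell `res-dim4-pi`, K2(p) lane; seat res-dim4-p-9 g6; filed under desk R-257)

[OURS · counted 0 · folklore arithmetic]  Nothing here proves anything about resolution of singularities, which in dimension ≥ 4 / characteristic
`p` is NOT proved.
bears_on: LADDER-RESOLUTION:D157-DOOR2 (res-dim4-pi · K2(p) L-light cell · tools).  Supports stmt-ResolutionOfSingularities-16155 (helper).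
-/

set_option linter.dupNamespace false -- mandated namespace of this single-conjunct summit

namespace Summit.ResolutionOfSingularities.ResolutionOfSingularities.Theorems.PIDim4

namespace ResCone

namespace LLight


/-- Pigeonhole on a bounded colour: a colouring of infinitely many times by colours `< p` has one colour at infinitely many times. [folklore] -/
theorem exists_colour_io {v : ℕ → ℕ} {p k₀ : ℕ} (hv : ∀ k, k₀ ≤ k → v k < p) :
    ∃ c, c < p ∧ ∀ N, ∃ k, N ≤ k ∧ k₀ ≤ k ∧ v k = c := by
  classical
  by_contra hno
  push Not at hno
  -- for every colour a time beyond which it does not occur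
  have hN : ∀ c, ∃ N, c < p → ∀ k, N ≤ k → k₀ ≤ k → v k ≠ c := by
    intro c
    by_cases hc : c < p
    · obtain ⟨N, hN⟩ := hno c hc
      exact ⟨N, fun _ k hk hk₀ h => hN k hk hk₀ h⟩
    · exact ⟨0, fun h => absurd h hc⟩
  choose N hN using hN
  set M : ℕ := k₀ + ∑ c ∈ Finset.range p, N c with hM
  have hMc : ∀ c, c < p → N c ≤ M := fun c hc => by
    have := Finset.single_le_sum (f := N) (fun _ _ => Nat.zero_le _) (Finset.mem_range.mpr hc)
    omega
  exact hN (v M) (hv M (by omega)) M (hMc _ (hv M (by omega))) (by omega) rfl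

/-- A minimum characterised twice is the same number. [folklore] -/
theorem min_unique {S : Finset (Fin 4 →₀ ℕ)} {f : (Fin 4 →₀ ℕ) → ℕ} {m m' : ℕ} (h1 : ∀ d ∈ S, m ≤ f d) (h1' : ∃ d ∈ S, f d = m)
    (h2 : ∀ d ∈ S, m' ≤ f d) (h2' : ∃ d ∈ S, f d = m') : m = m' := by
  obtain ⟨d, hd, hdm⟩ := h1'
  obtain ⟨d', hd', hdm'⟩ := h2'
  have := h1 d' hd'; have := h2 d hd; omega


/-- Four pairwise distinct letters exhaust `Fin 4`. [folklore] -/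
theorem letters_exhaust {A B ν φ : Fin 4} (hAB : A ≠ B) (hAν : A ≠ ν) (hAφ : A ≠ φ) (hBν : B ≠ ν) (hBφ : B ≠ φ) (hνφ : ν ≠ φ)
    (i : Fin 4) : i = A ∨ i = B ∨ i = ν ∨ i = φ := by
  have hcard : ({A, B, ν, φ} : Finset (Fin 4)) = Finset.univ := by
    apply Finset.eq_univ_of_card
    rw [Finset.card_insert_of_notMem (by simp [hAB, hAν, hAφ]), Finset.card_insert_of_notMem (by simp [hBν, hBφ]),
      Finset.card_pair hνφ, Fintype.card_fin]
  have : i ∈ ({A, B, ν, φ} : Finset (Fin 4)) := hcard ▸ Finset.mem_univ i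
  simpa only [Finset.mem_insert, Finset.mem_singleton] using this

end LLight

end ResCone

end Summit.ResolutionOfSingularities.ResolutionOfSingularities.Theorems.PIDim4
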